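import Summits.AnomalousDissipation.AnomalousDissipation.Theorems.BaireTransferDenseLoudDesignerForcesErgodicModelDefs
import Summits.AnomalousDissipation.AnomalousDissipation.Theorems.BaireTransferDenseLoudDesignerForcesErgodicFrameCurveDeriv
import Summits.AnomalousDissipation.AnomalousDissipation.Theorems.BaireTransferDenseLoudDesignerForcesErgodicFramePreimage
import Summits.AnomalousDissipation.AnomalousDissipation.Theorems.BaireTransferDenseLoudDesignerForcesErgodicGevreySmoothing
import Literature.Analysis.FluidPDE.TorusNSTimeDerivFieldsContinuity

/-!
# The time-derivative fields of the smooth model and their joint continuity (registered tools stub S6c₁ of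
# the crux `DenseLoudDesignerForces`, line ergodic-budget-selection-closing, block N-R)

Summit-side assembly of the registered tools stub `stub_modelTimeDerivativeFieldsTools` over the landed
vocabulary `…ErgodicModelDefs.lean` (`ModelFrame`, `ModelFrame.modelMap`), the frame-curve calculus of A3a
(`hasDerivWithinAt_stateOf`), the frame preimage S6₁ (`stub_framePreimageTools`), the Gevrey warm-up E9
(`stub_gevreySmoothingTools`) and the NS dictionary `Literature/Analysis/FluidPDE/TorusNSVectorFieldGevrey.lean`,
`…/TorusNSTimeDerivFieldsContinuity.lean` (pressure elimination `∂ₜu = G(u)`, `∂ₜ²u = E(u, ∂ₜu)`; uniform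
`L²`-continuity of `G`, `E` and their Laplacians on Gevrey balls).

With `g = F.modelMap ν xF U'` and, for `y ∈ U`, the classical orbit `u_y` with `F.S (g t y) = [u_y(t)]` on `(0, 3]`:
* `ModelFrame.hasDerivWithinAt_frame_stateOf` — the frame curve `s ↦ S([v s] − [Δ v s])` of ANY jointly smooth
  honest field is differentiable within the window, with derivative `S([∂ₜv] − [Δ∂ₜv])` (A3a pattern);
* `ModelFrame.timeField_hasDerivAt` — on a window `(a, 3)`, `t ↦ g t y` has derivative `S([∂ₜu_y] − [Δ∂ₜu_y])`
  and `t ↦ deriv (g · y) t` has derivative `S([∂ₜ²u_y] − [Δ∂ₜ²u_y])` (`g t y = S([u_y t] − [Δu_y t])` by S6₁ and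
  the injectivity of `S`; `∂ₜu_y` is again jointly smooth and honest, A1);
* `ModelFrame.norm_frame_sub_frame_le` — `‖S([v₁] − [Δv₁]) − S([v₂] − [Δv₂])‖ ≤ ‖S‖ (‖v₁ − v₂‖₂ + ‖Δ(v₁ − v₂)‖₂)`;
* `timeField_gevreyBound_slice`, `timeField_gevreyBound_force` — uniform Gevrey bounds of the orbit slices
  `u_y(t)`, `t ≥ a`, `y ∈ U` (E9 at the enstrophy level `E₂`, lapse `a/2`) and of the trigonometric force;
* `ModelFrame.timeField_modulus` — the joint modulus of continuity of both fields at a point of `(0,3) × U`: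
  `L²`-closeness of the slices comes from the joint continuity of `g` (`‖[u] − [u']‖ ≤ ‖S‖ ‖g q − g q'‖`), and the
  dictionary upgrades it to frame-closeness of `∂ₜu = G(u)` and `∂ₜ²u = E(u, G u)`;
* `stub_modelTimeDerivativeFieldsTools` — the registered signature.
References: Constantin–Foias 1988, Ch. 5 (5.9)–(5.10), Ch. 10–11; Foias–Temam 1989; Temam 1995 §3.4. [folklore]
-/
-- `Summit.<Summit>.<Problem>` is the tree's mandated summit-side namespace (CONVENTIONS §2); for this
-- single-conjunct summit the two coincide, so the duplicate is deliberate.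
set_option linter.dupNamespace false

noncomputable section

open Set Function MeasureTheory Filter
open scoped InnerProductSpace RealInnerProductSpace Topology

namespace Summit.AnomalousDissipation.AnomalousDissipation.Theorems.DenseLoudDesignerForces.Ergodic

open Literature.Analysis.FunctionSpaces Literature.Analysis.FunctionSpaces.Torus
open Literature.Analysis.FluidPDE Literature.Analysis.FluidPDE.Torus
open Summit.AnomalousDissipation.AnomalousDissipation.Theses.BaireTransfer
open Summit.AnomalousDissipation.AnomalousDissipation.Theorems.DenseLoudDesignerForces.Negative

namespace ModelFrame

variable (F : ModelFrame)

/-! ## Frame curves of jointly smooth honest fields -/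

/-- **The frame curve of a jointly smooth honest field is differentiable.** For `v` jointly smooth on
`[a, b] × T³` (`a < b`) with divergence-free mean-zero slices, `s ↦ S([v s] − [Δ v s])` has derivative
`S([∂ₜv t] − [Δ ∂ₜv t])` within `[a, b]` at every `t` (`∂ₜv = Torus.timeDerivWithin (Icc a b) v`): the state
curves of the honest fields `v`, `Δv` are differentiable with derivatives `[∂ₜv]`, `[∂ₜΔv] = [Δ∂ₜv]`
(`hasDerivWithinAt_stateOf`, `Torus.timeDerivWithin_laplacian_comm`) and `S` is bounded
(Constantin–Foias 1988, Ch. 5 (5.9)–(5.10)). [folklore] -/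
theorem hasDerivWithinAt_frame_stateOf {a b : ℝ} (hab : a < b)
    {v : ℝ → (UnitAddTorus (Fin 3)) → (EuclideanSpace ℝ (Fin 3))} (hv : IsSmoothSpaceTimeOn (Icc a b) v)
    (hd : ∀ s ∈ Icc a b, IsDivFree (v s)) (hm : ∀ s ∈ Icc a b, HasZeroMean (v s)) {t : ℝ} (ht : t ∈ Icc a b) :
    HasDerivWithinAt (fun s => F.S (stateOf (v s) - stateOf (laplacian (v s))))
      (F.S (stateOf (Torus.timeDerivWithin (Icc a b) v t) -
        stateOf (laplacian (Torus.timeDerivWithin (Icc a b) v t)))) (Icc a b) t := by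
  have hU : UniqueDiffOn ℝ (Icc a b) := uniqueDiffOn_Icc hab
  have hvs : ∀ s ∈ Icc a b, IsSmooth (v s) := fun s hs => hv.isSmooth_slice hs
  have hΔ : IsSmoothSpaceTimeOn (Icc a b) (fun s => laplacian (v s)) := hv.laplacian hU
  have hΔd : ∀ s ∈ Icc a b, IsDivFree (laplacian (v s)) := fun s hs =>
    IsDivFree.laplacian_of_isSmooth (hvs s hs) (hd s hs)
  have hΔm : ∀ s ∈ Icc a b, HasZeroMean (laplacian (v s)) := fun s hs =>
    integral_laplacian_eq_zero_of_isSmooth (hvs s hs)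
  have hcomm : Torus.timeDerivWithin (Icc a b) (fun s => laplacian (v s)) t =
      laplacian (Torus.timeDerivWithin (Icc a b) v t) :=
    funext fun x => timeDerivWithin_laplacian_comm hab hv ht x
  have h1 := hasDerivWithinAt_stateOf hab hv hd hm ht
  have h2 := hasDerivWithinAt_stateOf hab hΔ hΔd hΔm ht
  rw [hcomm] at h2
  exact F.S.hasFDerivAt.comp_hasDerivWithinAt t (h1.sub h2)

/-- **Frame distances are `H²`-type distances**: if `‖S x‖ ≤ M ‖x‖` (`M ≥ 0`, e.g. the operator norm of
`S`) then for honest smooth `v₁`, `v₂`,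
`‖S([v₁] − [Δv₁]) − S([v₂] − [Δv₂])‖ ≤ M (√∫‖v₁ − v₂‖² + √∫‖Δ(v₁ − v₂)‖²)` (`S` linear,
`‖[v] − [w]‖² = ∫‖v − w‖²`, `norm_stateOf_sub_sq`). [folklore] -/
theorem norm_frame_sub_frame_le {M : ℝ} (hM0 : 0 ≤ M) (hM : ∀ x : Hsp, ‖F.S x‖ ≤ M * ‖x‖)
    {v₁ v₂ : (UnitAddTorus (Fin 3)) → (EuclideanSpace ℝ (Fin 3))}
    (hv₁ : IsSmooth v₁) (hd₁ : IsDivFree v₁) (hm₁ : HasZeroMean v₁) (hv₂ : IsSmooth v₂) (hd₂ : IsDivFree v₂)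
    (hm₂ : HasZeroMean v₂) :
    ‖F.S (stateOf v₁ - stateOf (laplacian v₁)) - F.S (stateOf v₂ - stateOf (laplacian v₂))‖ ≤
      M * (Real.sqrt (∫ x, ‖v₁ x - v₂ x‖ ^ 2) + Real.sqrt (∫ x, ‖laplacian (fun y => v₁ y - v₂ y) x‖ ^ 2)) := by
  have hΔ₁ : IsSmooth (laplacian v₁) := hv₁.laplacian
  have hΔ₂ : IsSmooth (laplacian v₂) := hv₂.laplacian
  have hΔd₁ : IsDivFree (laplacian v₁) := IsDivFree.laplacian_of_isSmooth hv₁ hd₁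
  have hΔd₂ : IsDivFree (laplacian v₂) := IsDivFree.laplacian_of_isSmooth hv₂ hd₂
  have hΔm₁ : HasZeroMean (laplacian v₁) := integral_laplacian_eq_zero_of_isSmooth hv₁
  have hΔm₂ : HasZeroMean (laplacian v₂) := integral_laplacian_eq_zero_of_isSmooth hv₂
  have hn₁ : ‖stateOf v₁ - stateOf v₂‖ = Real.sqrt (∫ x, ‖v₁ x - v₂ x‖ ^ 2) := by
    rw [← norm_stateOf_sub_sq hv₁ hd₁ hm₁ hv₂ hd₂ hm₂, Real.sqrt_sq (norm_nonneg _)]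
  have hn₂ : ‖stateOf (laplacian v₁) - stateOf (laplacian v₂)‖ =
      Real.sqrt (∫ x, ‖laplacian (fun y => v₁ y - v₂ y) x‖ ^ 2) := by
    have hl : (∫ x, ‖laplacian (fun y => v₁ y - v₂ y) x‖ ^ 2) = ∫ x, ‖laplacian v₁ x - laplacian v₂ x‖ ^ 2 := by
      congr 1; funext x
      rw [show (fun y => v₁ y - v₂ y) = v₁ - v₂ from rfl, laplacian_sub hv₁ hv₂, Pi.sub_apply]
    rw [hl, ← norm_stateOf_sub_sq hΔ₁ hΔd₁ hΔm₁ hΔ₂ hΔd₂ hΔm₂, Real.sqrt_sq (norm_nonneg _)]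
  rw [← map_sub, ← hn₁, ← hn₂]
  calc ‖F.S ((stateOf v₁ - stateOf (laplacian v₁)) - (stateOf v₂ - stateOf (laplacian v₂)))‖
      ≤ M * ‖(stateOf v₁ - stateOf (laplacian v₁)) - (stateOf v₂ - stateOf (laplacian v₂))‖ := hM _
    _ = M * ‖(stateOf v₁ - stateOf v₂) - (stateOf (laplacian v₁) - stateOf (laplacian v₂))‖ := by
        congr 2; abel
    _ ≤ M * (‖stateOf v₁ - stateOf v₂‖ + ‖stateOf (laplacian v₁) - stateOf (laplacian v₂)‖) :=
        mul_le_mul_of_nonneg_left (norm_sub_le _ _) hM0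

/-! ## The two time-derivative fields along one orbit -/

/-- **The time-derivative fields of the model along a classical orbit.** Let `(u, p)` be a classical
solution of NS_ν on `(0, 3] × T³` with mean-zero slices whose states are the frame images of the model orbit,
`F.S (g t y) = [u t]` on `(0, 3]` (`g = F.modelMap ν xF U'`), and `0 < a < 3`. Then for `t ∈ (a, 3)`:
`s ↦ g s y` has derivative `S([∂ₜu t] − [Δ∂ₜu t])` at `t` and `s ↦ deriv (g · y) s` has derivative
`S([∂ₜ∂ₜu t] − [Δ∂ₜ∂ₜu t])` at `t` (time derivatives within `[a, 3]`): `g s y = S([u s] − [Δu s])` on `[a, 3]`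
(S6₁ `stub_framePreimageTools` and the injectivity of `S`), `ModelFrame.hasDerivWithinAt_frame_stateOf` for the
honest jointly smooth fields `u` and `∂ₜu` (A1 `timeDerivWithin_isLinearised_of_steady`), interior points, and
`deriv (g · y) = S([∂ₜu] − [Δ∂ₜu])` on the open window. [folklore] -/
theorem timeField_hasDerivAt {ν : ℝ} (xF : Hsp) (U' : Set Hsp) {y : Hsp}
    {f : (UnitAddTorus (Fin 3)) → (EuclideanSpace ℝ (Fin 3))}
    {u : ℝ → (UnitAddTorus (Fin 3)) → (EuclideanSpace ℝ (Fin 3))} {p : ℝ → (UnitAddTorus (Fin 3)) → ℝ}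
    (hsol : IsClassicalNSSolutionOn (Ioc 0 3) ν (fun _ => f) u p) (hmean : ∀ t ∈ Ioc (0 : ℝ) 3, HasZeroMean (u t))
    (hSg : ∀ t ∈ Ioc (0 : ℝ) 3, F.S (F.modelMap ν xF U' t y) = stateOf (u t)) {a : ℝ} (ha : 0 < a) (ha3 : a < 3)
    {t : ℝ} (ht : t ∈ Ioo a 3) :
    HasDerivAt (fun s => F.modelMap ν xF U' s y)
      (F.S (stateOf (Torus.timeDerivWithin (Icc a 3) u t) -
        stateOf (laplacian (Torus.timeDerivWithin (Icc a 3) u t)))) t ∧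
    HasDerivAt (fun s => deriv (fun r => F.modelMap ν xF U' r y) s)
      (F.S (stateOf (Torus.timeDerivWithin (Icc a 3) (Torus.timeDerivWithin (Icc a 3) u) t) -
        stateOf (laplacian (Torus.timeDerivWithin (Icc a 3) (Torus.timeDerivWithin (Icc a 3) u) t)))) t := by
  have hI : Icc a 3 ⊆ Ioc (0 : ℝ) 3 := fun s hs => ⟨ha.trans_le hs.1, hs.2⟩
  have hsolW : IsClassicalNSSolutionOn (Icc a 3) ν (fun _ => f) u p := hsol.mono hI (uniqueDiffOn_Icc ha3)
  have hmeanW : ∀ s ∈ Icc a 3, HasZeroMean (u s) := fun s hs => hmean s (hI hs)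
  have hu : IsSmoothSpaceTimeOn (Icc a 3) u := hsolW.smooth_velocity
  have hus : ∀ s ∈ Icc a 3, IsSmooth (u s) := fun s hs => hu.isSmooth_slice hs
  -- the orbit is the frame curve of `u` on the window
  have hframe : ∀ s ∈ Icc a 3, F.modelMap ν xF U' s y = F.S (stateOf (u s) - stateOf (laplacian (u s))) := by
    intro s hs
    apply F.hSinj
    rw [hSg s (hI hs), stub_framePreimageTools F.ι F.b F.m F.hmodes F.S F.hS (hus s hs) (hsolW.divFree s hs)
      (hmeanW s hs)]
  have h1 : ∀ s ∈ Ioo a 3, HasDerivAt (fun r => F.modelMap ν xF U' r y)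
      (F.S (stateOf (Torus.timeDerivWithin (Icc a 3) u s) -
        stateOf (laplacian (Torus.timeDerivWithin (Icc a 3) u s)))) s := by
    intro s hs
    have hsI : s ∈ Icc a 3 := Ioo_subset_Icc_self hs
    have h := F.hasDerivWithinAt_frame_stateOf ha3 hu hsolW.divFree hmeanW hsI
    exact (h.congr (fun r hr => hframe r hr) (hframe s hsI)).hasDerivAt (Icc_mem_nhds hs.1 hs.2)
  refine ⟨h1 t ht, ?_⟩
  -- the time derivative `∂ₜu` is jointly smooth and honest (A1)
  obtain ⟨hv, -, hvdiv, hvmean, -⟩ := hsolW.timeDerivWithin_isLinearised_of_steady ha3 hmeanW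
  have h2 := (F.hasDerivWithinAt_frame_stateOf ha3 hv hvdiv hvmean (Ioo_subset_Icc_self ht)).hasDerivAt
    (Icc_mem_nhds ht.1 ht.2)
  refine h2.congr_of_eventuallyEq ?_
  filter_upwards [Ioo_mem_nhds ht.1 ht.2] with s hs
  exact (h1 s hs).deriv

end ModelFrame

/-! ## Uniform Gevrey bounds along the tube -/

/-- **Uniform Gevrey bound of the orbit slices after a warm-up** (E9 at the enstrophy level `E₂`, lapse
`a/2`): for `ν > 0`, `a > 0` and the designer force there are `σ > 0`, `C` such that every classical solution
of NS_ν(`force S c`) on `(0, 3] × T³` with mean-zero slices and `‖∇u(t)‖₂² ≤ E₂` satisfies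
`∑_{k∈S'} e^{2σ|k|} ‖û(t, k)‖² ≤ C` for every `t ∈ [a, 3]` and every finite `S'` (apply `stub_gevreySmoothingTools`
on the window `[t − a/2, t] ⊂ (0, 3]`). [cite: FoiasTemam1989, Thm 1.1] -/
theorem timeField_gevreyBound_slice {S : Finset (Fin 3 → ℤ)} {c : ↥S → (EuclideanSpace ℂ (Fin 3))} {ν : ℝ}
    (hν : 0 < ν) (E₂ : ℝ) {a : ℝ} (ha : 0 < a) :
    ∃ σ : ℝ, 0 < σ ∧ ∃ C : ℝ, ∀ {u : ℝ → (UnitAddTorus (Fin 3)) → (EuclideanSpace ℝ (Fin 3))}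
      {p : ℝ → (UnitAddTorus (Fin 3)) → ℝ},
      IsClassicalNSSolutionOn (Ioc 0 3) ν (fun _ => force S c) u p → (∀ t ∈ Ioc (0 : ℝ) 3, HasZeroMean (u t)) →
      (∀ t ∈ Ioc (0 : ℝ) 3, gradNormSq (u t) ≤ E₂) →
      ∀ t ∈ Icc a 3, ∀ S' : Finset (Fin 3 → ℤ), ∑ k ∈ S', Real.exp (2 * σ * Real.sqrt (freqNormSq k)) *
        ‖UnitAddTorus.mFourierCoeff (EuclideanSpace.complexify ∘ u t) k‖ ^ 2 ≤ C := by
  obtain ⟨σ, hσ, C, hC⟩ := stub_gevreySmoothingTools hν E₂ (a / 2) (half_pos ha) S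
    (fun k => Torus.lerayCoeff k (Torus.coeffExt S c k))
  refine ⟨σ, hσ, C, fun {u p} hsol hmean hE t ht S' => ?_⟩
  have hI : Icc (t - a / 2) (t - a / 2 + a / 2) ⊆ Ioc (0 : ℝ) 3 := fun s hs =>
    ⟨by linarith [hs.1, ht.1], by linarith [hs.2, ht.2]⟩
  have hsolW : IsClassicalNSSolutionOn (Icc (t - a / 2) (t - a / 2 + a / 2)) ν (fun _ => force S c) u p :=
    hsol.mono hI (uniqueDiffOn_Icc (by linarith))
  have h := hC hsolW (fun s hs => hmean s (hI hs)) (fun s hs => hE s (hI hs)) S'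
  rwa [sub_add_cancel] at h

/-- **The designer force is a trigonometric polynomial, hence Gevrey at every radius**: its Fourier
coefficients vanish off `S ∪ (−S)` (`Torus.mFourierCoeff_realTrigPoly_eq_zero_of_not_mem`), so
`∑_{k∈S'} e^{2σ|k|} ‖f̂(k)‖² ≤ ∑_{k ∈ S ∪ (−S)} e^{2σ|k|} ‖f̂(k)‖²` (`Torus.gevreyBound_of_eq_zero_off`). [folklore] -/
theorem timeField_gevreyBound_force (S : Finset (Fin 3 → ℤ)) (c : ↥S → (EuclideanSpace ℂ (Fin 3))) (σ : ℝ)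
    (S' : Finset (Fin 3 → ℤ)) :
    ∑ k ∈ S', Real.exp (2 * σ * Real.sqrt (freqNormSq k)) *
        ‖UnitAddTorus.mFourierCoeff (EuclideanSpace.complexify ∘ force S c) k‖ ^ 2 ≤
      ∑ k ∈ S ∪ S.image (fun k => -k), Real.exp (2 * σ * Real.sqrt (freqNormSq k)) *
        ‖UnitAddTorus.mFourierCoeff (EuclideanSpace.complexify ∘ force S c) k‖ ^ 2 := by
  classical
  refine gevreyBound_of_eq_zero_off (S ∪ S.image (fun k => -k)) (fun k hk => ?_) S'
  have hk1 : k ∉ S := fun h1 => hk (Finset.mem_union_left _ h1)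
  have hk2 : -k ∉ S := fun h2 => hk (Finset.mem_union_right _ (Finset.mem_image.2 ⟨-k, h2, neg_neg k⟩))
  exact mFourierCoeff_realTrigPoly_eq_zero_of_not_mem _ hk1 hk2

namespace ModelFrame

variable (F : ModelFrame)

/-! ## The joint modulus of continuity of the two fields -/

set_option maxHeartbeats 400000 in
/-- **Joint modulus of continuity of the two time-derivative fields at a point of `(0, 3) × U`.**  In the
setting of `stub_modelTimeDerivativeFieldsTools` (classical orbits `u_y` with `F.S (g t y) = [u_y t]`,
uniform enstrophy level `E₂`, `g` jointly continuous on `[0, 3] × U`): for `q₀ = (t₀, y₀) ∈ (0,3) × U` and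
`ε > 0` there is `δ > 0` such that for all `q = (t, y) ∈ (0, 3) × U` with `dist q q₀ < δ` both
`deriv (g · y) t` and `deriv (deriv (g · y)) t` are `ε`-close to their values at `q₀`.  Proof: on the window
`(t₀/2, 3)` these are `S([∂ₜu_y t] − [Δ∂ₜu_y t])` and `S([∂ₜ²u_y t] − [Δ∂ₜ²u_y t])`
(`ModelFrame.timeField_hasDerivAt`) with `∂ₜu = G(u)`, `∂ₜ²u = E(u, ∂ₜu)` pointwise
(`Torus.IsClassicalNSSolutionOn.timeDerivWithin_eq_nsVectorField`, `Torus.eq_linearisedField_of_linearised`); the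
slices `u_y(t)`, `t ≥ t₀/2`, lie in one Gevrey ball (`timeField_gevreyBound_slice`) and
`∫‖u_y t − u_{y₀} t₀‖² = ‖F.S (g q − g q₀)‖² ≤ ‖S‖² ‖g q − g q₀‖²` is small by the joint continuity of `g`, so
`Torus.exists_forall_nsTimeDerivFields_sub_le` and `ModelFrame.norm_frame_sub_frame_le` give the claim. [folklore] -/
theorem timeField_modulus {S : Finset (Fin 3 → ℤ)} {c : ↥S → (EuclideanSpace ℂ (Fin 3))} {ν : ℝ} (hν : 0 < ν)
    (xF : Hsp) {U U' : Set Hsp}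
    (hcont : ContinuousOn (fun q : ℝ × Hsp => F.modelMap ν xF U' q.1 q.2) (Icc (0 : ℝ) 3 ×ˢ U)) {E₂ : ℝ}
    (u : ∀ y ∈ U, ℝ → (UnitAddTorus (Fin 3)) → (EuclideanSpace ℝ (Fin 3)))
    (p : ∀ y ∈ U, ℝ → (UnitAddTorus (Fin 3)) → ℝ)
    (hsol : ∀ (y : Hsp) (hy : y ∈ U), IsClassicalNSSolutionOn (Ioc 0 3) ν (fun _ => force S c) (u y hy) (p y hy))
    (hmean : ∀ (y : Hsp) (hy : y ∈ U), ∀ t ∈ Ioc (0 : ℝ) 3, HasZeroMean (u y hy t))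
    (hE : ∀ (y : Hsp) (hy : y ∈ U), ∀ t ∈ Ioc (0 : ℝ) 3, gradNormSq (u y hy t) ≤ E₂)
    (hSg : ∀ (y : Hsp) (hy : y ∈ U), ∀ t ∈ Ioc (0 : ℝ) 3, F.S (F.modelMap ν xF U' t y) = stateOf (u y hy t))
    {q₀ : ℝ × Hsp} (hq₀ : q₀ ∈ Ioo (0 : ℝ) 3 ×ˢ U) {ε : ℝ} (hε : 0 < ε) :
    ∃ δ : ℝ, 0 < δ ∧ ∀ q ∈ Ioo (0 : ℝ) 3 ×ˢ U, dist q q₀ < δ →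
      dist (deriv (fun t => F.modelMap ν xF U' t q.2) q.1) (deriv (fun t => F.modelMap ν xF U' t q₀.2) q₀.1) < ε ∧
      dist (deriv (fun t => deriv (fun s => F.modelMap ν xF U' s q.2) t) q.1)
        (deriv (fun t => deriv (fun s => F.modelMap ν xF U' s q₀.2) t) q₀.1) < ε := by
  obtain ⟨⟨ht₀0, ht₀3⟩, hy₀⟩ := mem_prod.1 hq₀
  obtain ⟨hf, hfdiv, -⟩ := stub_designerForceTools S c
  set a : ℝ := q₀.1 / 2 with ha_def
  have ha : 0 < a := by rw [ha_def]; linarith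
  have ha3 : a < 3 := by rw [ha_def]; linarith
  have hI : Icc a 3 ⊆ Ioc (0 : ℝ) 3 := fun s hs => ⟨ha.trans_le hs.1, hs.2⟩
  have hUD : UniqueDiffOn ℝ (Icc a 3) := uniqueDiffOn_Icc ha3
  -- uniform Gevrey bounds of slices and force
  obtain ⟨σ, hσ, C, hC⟩ := timeField_gevreyBound_slice (S := S) (c := c) hν E₂ ha
  have hGf := timeField_gevreyBound_force S c (σ / 2)
  -- the operator norm of the frame (kept as an opaque constant `M`)
  obtain ⟨M, hM0, hMle⟩ : ∃ M : ℝ, 0 ≤ M ∧ ∀ x : Hsp, ‖F.S x‖ ≤ M * ‖x‖ :=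
    ⟨‖F.S‖, F.S.opNorm_nonneg, fun x => F.S.le_opNorm x⟩
  -- the `L²` modulus of the dictionary
  set ε' : ℝ := (ε / (4 * (M + 1))) ^ 2 with hε'
  have hS0 : 0 < M + 1 := by linarith
  have hε'0 : 0 < ε' := by positivity
  have hsqε' : Real.sqrt ε' = ε / (4 * (M + 1)) := Real.sqrt_sq (by positivity)
  obtain ⟨δ₁, hδ₁, hmod⟩ := exists_forall_nsTimeDerivFields_sub_le (d := Fin 3) (Fintype.card_fin 3) ν σ C _ hσ hf
    hGf hε'0
  -- the joint continuity of `g` at `q₀`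
  set η : ℝ := Real.sqrt δ₁ / (M + 1) with hη
  have hη0 : 0 < η := div_pos (Real.sqrt_pos.2 hδ₁) hS0
  have hq₀' : q₀ ∈ Icc (0 : ℝ) 3 ×ˢ U := mem_prod.2 ⟨⟨ht₀0.le, ht₀3.le⟩, hy₀⟩
  obtain ⟨ρ, hρ, hρc⟩ := Metric.continuousWithinAt_iff.1 (hcont q₀ hq₀') η hη0
  refine ⟨min ρ a, lt_min hρ ha, fun q hq hdist => ?_⟩
  obtain ⟨⟨ht0, ht3⟩, hy⟩ := mem_prod.1 hq
  -- `q.1` lies in the window `(a, 3)`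
  have htt₀ : |q.1 - q₀.1| < a := by
    have h1 : dist q.1 q₀.1 ≤ dist q q₀ := by rw [Prod.dist_eq]; exact le_max_left _ _
    rw [← Real.dist_eq]; exact h1.trans_lt (hdist.trans_le (min_le_right _ _))
  have hta : a < q.1 := by
    rw [ha_def] at htt₀ ⊢
    have := (abs_lt.1 htt₀).1
    linarith
  have hq1 : q.1 ∈ Ioo a 3 := ⟨hta, ht3⟩
  have hq₀1 : q₀.1 ∈ Ioo a 3 := ⟨by rw [ha_def]; linarith, ht₀3⟩
  -- the fields at `q` and `q₀`
  obtain ⟨hD1, hD2⟩ := F.timeField_hasDerivAt xF U' (hsol q.2 hy) (hmean q.2 hy) (hSg q.2 hy) ha ha3 hq1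
  obtain ⟨hD1₀, hD2₀⟩ := F.timeField_hasDerivAt xF U' (hsol q₀.2 hy₀) (hmean q₀.2 hy₀) (hSg q₀.2 hy₀) ha ha3 hq₀1
  rw [hD1.deriv, hD1₀.deriv, hD2.deriv, hD2₀.deriv, dist_eq_norm, dist_eq_norm]
  -- classical data on the window
  have hsolW : ∀ (z : Hsp) (hz : z ∈ U), IsClassicalNSSolutionOn (Icc a 3) ν (fun _ => force S c) (u z hz) (p z hz) :=
    fun z hz => (hsol z hz).mono hI hUD
  have hmeanW : ∀ (z : Hsp) (hz : z ∈ U), ∀ s ∈ Icc a 3, HasZeroMean (u z hz s) :=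
    fun z hz s hs => hmean z hz s (hI hs)
  set w : (UnitAddTorus (Fin 3)) → (EuclideanSpace ℝ (Fin 3)) := Torus.timeDerivWithin (Icc a 3) (u q.2 hy) q.1 with hw
  set w₀ : (UnitAddTorus (Fin 3)) → (EuclideanSpace ℝ (Fin 3)) := Torus.timeDerivWithin (Icc a 3) (u q₀.2 hy₀) q₀.1
    with hw₀
  have htI : q.1 ∈ Icc a 3 := Ioo_subset_Icc_self hq1; have ht₀I : q₀.1 ∈ Icc a 3 := Ioo_subset_Icc_self hq₀1
  obtain ⟨hv, hvp, hvdiv, hvmean, hlin⟩ := (hsolW q.2 hy).timeDerivWithin_isLinearised_of_steady ha3 (hmeanW q.2 hy)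
  obtain ⟨hv₀, hvp₀, hvdiv₀, hvmean₀, hlin₀⟩ :=
    (hsolW q₀.2 hy₀).timeDerivWithin_isLinearised_of_steady ha3 (hmeanW q₀.2 hy₀)
  have hus : IsSmooth (u q.2 hy q.1) := (hsolW q.2 hy).smooth_velocity.isSmooth_slice htI
  have hus₀ : IsSmooth (u q₀.2 hy₀ q₀.1) := (hsolW q₀.2 hy₀).smooth_velocity.isSmooth_slice ht₀I
  have hws : IsSmooth w := hv.isSmooth_slice htI; have hws₀ : IsSmooth w₀ := hv₀.isSmooth_slice ht₀I
  -- `∂ₜu = G(u)` and `∂ₜ(∂ₜu) = E(u, ∂ₜu)` pointwise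
  have hweq := fun x => (hsolW q.2 hy).timeDerivWithin_eq_nsVectorField ha3 hf hfdiv htI x
  have hweq₀ := fun x => (hsolW q₀.2 hy₀).timeDerivWithin_eq_nsVectorField ha3 hf hfdiv ht₀I x
  have hDw := hv.isSmooth_timeDerivWithin hUD htI
  have hDw₀ := hv₀.isSmooth_timeDerivWithin hUD ht₀I
  have hDwd := hv.isDivFree_timeDerivWithin ha3 hvdiv htI
  have hDwd₀ := hv₀.isDivFree_timeDerivWithin ha3 hvdiv₀ ht₀I
  have hDwm := hv.hasZeroMean_timeDerivWithin ha3 hvmean htI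
  have hDwm₀ := hv₀.hasZeroMean_timeDerivWithin ha3 hvmean₀ ht₀I
  have hEeq := fun x => eq_linearisedField_of_linearised hDw hDwd hus hws (hvdiv q.1 htI) (hvp.isSmooth_slice htI)
    (hlin q.1 htI) x
  have hEeq₀ := fun x => eq_linearisedField_of_linearised hDw₀ hDwd₀ hus₀ hws₀ (hvdiv₀ q₀.1 ht₀I)
    (hvp₀.isSmooth_slice ht₀I) (hlin₀ q₀.1 ht₀I) x
  -- `L²`-closeness of the slices from the joint continuity of `g`
  have hL2 : (∫ x, ‖u q.2 hy q.1 x - u q₀.2 hy₀ q₀.1 x‖ ^ 2) ≤ δ₁ := by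
    have hq' : q ∈ Icc (0 : ℝ) 3 ×ˢ U := mem_prod.2 ⟨⟨ht0.le, ht3.le⟩, hy⟩
    have hg : dist (F.modelMap ν xF U' q.1 q.2) (F.modelMap ν xF U' q₀.1 q₀.2) < η :=
      hρc hq' (hdist.trans_le (min_le_left _ _))
    rw [dist_eq_norm] at hg
    rw [← norm_stateOf_sub_sq hus ((hsolW q.2 hy).divFree q.1 htI) (hmeanW q.2 hy q.1 htI) hus₀
      ((hsolW q₀.2 hy₀).divFree q₀.1 ht₀I) (hmeanW q₀.2 hy₀ q₀.1 ht₀I), ← hSg q.2 hy q.1 ⟨ht0, ht3.le⟩,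
      ← hSg q₀.2 hy₀ q₀.1 ⟨ht₀0, ht₀3.le⟩, ← map_sub]
    have h1 : ‖F.S (F.modelMap ν xF U' q.1 q.2 - F.modelMap ν xF U' q₀.1 q₀.2)‖ ≤ M * η :=
      (hMle _).trans (mul_le_mul_of_nonneg_left hg.le hM0)
    have h2 : M * η ≤ Real.sqrt δ₁ := by
      rw [hη, mul_div_assoc', div_le_iff₀ hS0]
      nlinarith [Real.sqrt_nonneg δ₁]
    have h3 := h1.trans h2
    calc ‖F.S (F.modelMap ν xF U' q.1 q.2 - F.modelMap ν xF U' q₀.1 q₀.2)‖ ^ 2 ≤ Real.sqrt δ₁ ^ 2 :=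
          pow_le_pow_left₀ (norm_nonneg _) h3 2
      _ = δ₁ := Real.sq_sqrt hδ₁.le
  -- the dictionary
  obtain ⟨b1, b2, b3, b4⟩ := hmod (u q.2 hy q.1) (u q₀.2 hy₀ q₀.1) w w₀ hus hus₀ (hmeanW q.2 hy q.1 htI)
    (hmeanW q₀.2 hy₀ q₀.1 ht₀I) (hC (hsol q.2 hy) (hmean q.2 hy) (hE q.2 hy) q.1 htI)
    (hC (hsol q₀.2 hy₀) (hmean q₀.2 hy₀) (hE q₀.2 hy₀) q₀.1 ht₀I) hws hws₀ hweq hweq₀ hL2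
  -- the first field
  have hbound : M * (Real.sqrt ε' + Real.sqrt ε') < ε := by
    rw [hsqε']
    have h : M * (ε / (4 * (M + 1)) + ε / (4 * (M + 1))) = ε / 2 * (M / (M + 1)) := by
      field_simp; ring
    rw [h]
    have h1 : M / (M + 1) ≤ 1 := (div_le_one hS0).2 (by linarith)
    nlinarith [div_nonneg hM0 hS0.le]
  refine ⟨?_, ?_⟩
  · have h := F.norm_frame_sub_frame_le hM0 hMle hws (hvdiv q.1 htI) (hvmean q.1 htI) hws₀ (hvdiv₀ q₀.1 ht₀I)
      (hvmean₀ q₀.1 ht₀I)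
    exact h.trans_lt ((mul_le_mul_of_nonneg_left (add_le_add (Real.sqrt_le_sqrt b1) (Real.sqrt_le_sqrt b2))
      hM0).trans_lt hbound)
  · have h := F.norm_frame_sub_frame_le hM0 hMle hDw hDwd hDwm hDw₀ hDwd₀ hDwm₀
    rw [show Torus.timeDerivWithin (Icc a 3) (Torus.timeDerivWithin (Icc a 3) (u q.2 hy)) q.1 = _ from funext hEeq,
      show Torus.timeDerivWithin (Icc a 3) (Torus.timeDerivWithin (Icc a 3) (u q₀.2 hy₀)) q₀.1 = _ from
        funext hEeq₀] at h ⊢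
    exact h.trans_lt ((mul_le_mul_of_nonneg_left (add_le_add (Real.sqrt_le_sqrt b3) (Real.sqrt_le_sqrt b4))
      hM0).trans_lt hbound)

end ModelFrame

/-! ## The registered tools stub -/

/-- **Tools stub S6c₁ — THE TIME-DERIVATIVE FIELDS OF THE MODEL AND THEIR JOINT CONTINUITY (block N-R).**
With `g = F.modelMap ν xF U'`: for every `y ∈ U` the orbit `t ↦ g t y` is twice differentiable on `(0, 3)` in
`Hsp`, and the two canonical fields `(t, y) ↦ ∂ₜg`, `(t, y) ↦ ∂ₜ²g` are jointly continuous on `(0, 3) × U`.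
Proof: by `hclass` the orbit is the frame curve `S([u_y t] − [Δu_y t])` of a classical solution (S6₁ and the
injectivity of `S`), whose frame-time-derivatives exist by the A3a calculus applied to `u_y` and to the honest
jointly smooth field `∂ₜu_y` (A1) — `ModelFrame.timeField_hasDerivAt`; the joint continuity is
`ModelFrame.timeField_modulus`: uniform Gevrey bounds after the warm-up (E9), `L²`-closeness of slices from
`hcont`, and the NS dictionary `∂ₜu = G(u)`, `∂ₜ²u = E(u, G u)` with its uniform `L²`/`H²`-continuity on Gevrey
balls (`Torus.exists_forall_nsTimeDerivFields_sub_le`). The hypotheses `hU`, `hU'`, `hbdd`, `hUU'`, `htube` of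
the registered interface are not needed. [folklore] -/
theorem stub_modelTimeDerivativeFieldsTools {S : Finset (Fin 3 → ℤ)} {c : ↥S → (EuclideanSpace ℂ (Fin 3))} {ν : ℝ} (hν : 0 < ν)
    (F : ModelFrame) (xF : Hsp) (hxF : F.S xF = stateOf (force S c)) {U U' : Set Hsp} (hU : IsOpen U) (hU' : IsOpen U')
    (hbdd : Bornology.IsBounded U') (hUU' : U ⊆ U')
    (htube : ∀ y ∈ U, ∀ t ∈ Icc (0 : ℝ) 3, ∃ (ht : 0 ≤ t) (z : C(Icc (0 : ℝ) t, Hsp)),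
      F.IsMild ν xF ht y z ∧ (∀ r, z r ∈ U') ∧ F.modelMap ν xF U' t y = z ⟨t, ht, le_rfl⟩)
    (hcont : ContinuousOn (fun q : ℝ × Hsp => F.modelMap ν xF U' q.1 q.2) (Icc (0 : ℝ) 3 ×ˢ U)) {E₂ : ℝ}
    (hclass : ∀ y ∈ U, ∃ (u : ℝ → (UnitAddTorus (Fin 3)) → (EuclideanSpace ℝ (Fin 3))) (p : ℝ → (UnitAddTorus (Fin 3)) → ℝ),
      IsClassicalNSSolutionOn (Ioc 0 3) ν (fun _ => force S c) u p ∧ (∀ t ∈ Ioc (0 : ℝ) 3, HasZeroMean (u t)) ∧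
      (∀ t ∈ Ioc (0 : ℝ) 3, gradNormSq (u t) ≤ E₂) ∧ ∀ t ∈ Ioc (0 : ℝ) 3, F.S (F.modelMap ν xF U' t y) = stateOf (u t)) :
    (∀ q ∈ Ioo (0 : ℝ) 3 ×ˢ U, HasDerivAt (fun t => F.modelMap ν xF U' t q.2) (deriv (fun t => F.modelMap ν xF U' t q.2) q.1) q.1) ∧
    (∀ q ∈ Ioo (0 : ℝ) 3 ×ˢ U, HasDerivAt (fun t => deriv (fun s => F.modelMap ν xF U' s q.2) t)
      (deriv (fun t => deriv (fun s => F.modelMap ν xF U' s q.2) t) q.1) q.1) ∧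
    ContinuousOn (fun q : ℝ × Hsp => deriv (fun t => F.modelMap ν xF U' t q.2) q.1) (Ioo (0 : ℝ) 3 ×ˢ U) ∧
    ContinuousOn (fun q : ℝ × Hsp => deriv (fun t => deriv (fun s => F.modelMap ν xF U' s q.2) t) q.1) (Ioo (0 : ℝ) 3 ×ˢ U) := by
  -- the registered interface carries the tube data of the neighbouring stubs; they are not needed here
  have _ := hxF; have _ := hU; have _ := hU'; have _ := hbdd; have _ := hUU'; have _ := htube
  choose u p hsol hmean hE hSg using hclass
  -- differentiability at `q = (t, y)`: the window `(t/2, 3)`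
  have hwin : ∀ q ∈ Ioo (0 : ℝ) 3 ×ˢ U, 0 < q.1 / 2 ∧ q.1 / 2 < 3 ∧ q.1 ∈ Ioo (q.1 / 2) 3 := fun q hq => by
    obtain ⟨⟨ht0, ht3⟩, -⟩ := mem_prod.1 hq
    exact ⟨by linarith, by linarith, by linarith, ht3⟩
  refine ⟨fun q hq => ?_, fun q hq => ?_, fun q₀ hq₀ => ?_, fun q₀ hq₀ => ?_⟩
  · obtain ⟨ha, ha3, ht⟩ := hwin q hq
    have hy := (mem_prod.1 hq).2
    exact (F.timeField_hasDerivAt xF U' (hsol q.2 hy) (hmean q.2 hy) (hSg q.2 hy) ha ha3 ht).1.differentiableAt.hasDerivAt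
  · obtain ⟨ha, ha3, ht⟩ := hwin q hq
    have hy := (mem_prod.1 hq).2
    exact (F.timeField_hasDerivAt xF U' (hsol q.2 hy) (hmean q.2 hy) (hSg q.2 hy) ha ha3 ht).2.differentiableAt.hasDerivAt
  · refine Metric.continuousWithinAt_iff.2 fun ε hε => ?_
    obtain ⟨δ, hδ, h⟩ := F.timeField_modulus hν xF hcont u p hsol hmean hE hSg hq₀ hε
    exact ⟨δ, hδ, fun {q} hq hdist => (h q hq hdist).1⟩
  · refine Metric.continuousWithinAt_iff.2 fun ε hε => ?_
    obtain ⟨δ, hδ, h⟩ := F.timeField_modulus hν xF hcont u p hsol hmean hE hSg hq₀ hε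
    exact ⟨δ, hδ, fun {q} hq hdist => (h q hq hdist).2⟩

end Summit.AnomalousDissipation.AnomalousDissipation.Theorems.DenseLoudDesignerForces.Ergodic

end
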